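import Mathlib

/-!
# `Valuative.TorsorToLurelFfinite`: generators of `K` over `k^{pⁿ}` for an `F`-finite field `k`

Route `ResolutionOfSingularities/Valuative`, support item `TorsorToLurelFfinite`
(stmt-ResolutionOfSingularities-0643). Helper file (this is where `[k : k^p] < ∞` is used).

* `exists_finset_closure_range_iterateFrobenius_eq_top` — if `k` is finite over `k^p`
  (`Module.Finite (frobenius k p).range k`) then, for every `n`, `k` is generated as a field over
  `k^{pⁿ}` by finitely many elements (induction on `n`: if `k = k^p(B₁)` and `k = k^{pⁿ}(B_n)` then
  `k^{pⁿ} = k^{p^{n+1}}(B₁^{pⁿ})`, so `k = k^{p^{n+1}}(B₁^{pⁿ} ∪ B_n)`).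
* `exists_finset_generators_mem` — a finitely generated extension `K/k` is generated by finitely
  many elements of any given valuation ring `O` of `K` (invert the generators not in `O`).
* `exists_finset_generators_over_frobeniusBaseField` — hence, if moreover `k ⊆ O`, there is a
  finite `G ⊆ O` such that every intermediate field of `K / k^{pⁿ}` containing `G` is all of `K`
  (`k^{pⁿ} ⊆ K` being the subfield `((algebraMap k K).comp (iterateFrobenius k p n)).fieldRange`).
-/

noncomputable section

set_option linter.dupNamespace false -- mandated namespace of this single-conjunct summit

namespace Summit.ResolutionOfSingularities.ResolutionOfSingularities.Theorems

universe u

/-- **`F`-finiteness iterates (field form).** If `k` is a finite `k^p`-module then for every `n`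
there is a finite set `B ⊆ k` with `k = k^{pⁿ}(B)`. -/
theorem exists_finset_closure_range_iterateFrobenius_eq_top (k : Type u) [Field k] (p : ℕ)
    [Fact p.Prime] [CharP k p] (hF : Module.Finite (frobenius k p).range k) (n : ℕ) :
    ∃ B : Finset k,
      Subfield.closure (Set.range (iterateFrobenius k p n) ∪ (B : Set k)) = ⊤ := by
  classical
  -- the case `n = 1`, from the module-finiteness hypothesis
  obtain ⟨B₁, hB₁⟩ := Module.finite_def.mp hF
  have h1 : ∀ c : k, c ∈ Subfield.closure (Set.range (frobenius k p) ∪ (B₁ : Set k)) := by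
    intro c
    have hc : c ∈ Submodule.span (frobenius k p).range (B₁ : Set k) := by
      rw [hB₁]; exact Submodule.mem_top
    refine Submodule.span_induction (p := fun x _ =>
      x ∈ Subfield.closure (Set.range (frobenius k p) ∪ (B₁ : Set k))) ?_ ?_ ?_ ?_ hc
    · intro x hx
      exact Subfield.subset_closure (Or.inr hx)
    · exact zero_mem _
    · intro x y _ _ hx hy
      exact add_mem hx hy
    · intro r x _ hx
      rw [Subring.smul_def, smul_eq_mul]
      obtain ⟨a, ha⟩ := r.2
      exact mul_mem (Subfield.subset_closure (Or.inl ⟨a, ha⟩)) hx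
  induction n with
  | zero =>
    refine ⟨∅, ?_⟩
    rw [eq_top_iff]
    intro x _
    exact Subfield.subset_closure (Or.inl ⟨x, by rw [iterateFrobenius_def, pow_zero, pow_one]⟩)
  | succ n ih =>
    obtain ⟨Bn, hBn⟩ := ih
    set φ : k →+* k := iterateFrobenius k p n with hφ
    refine ⟨B₁.image φ ∪ Bn, ?_⟩
    rw [eq_top_iff, ← hBn, Subfield.closure_le]
    rintro x (⟨a, rfl⟩ | hx)
    · -- `φ a ∈ φ (k^p(B₁)) = k^{p^{n+1}}(φ B₁)`
      have ha : φ a ∈ (Subfield.closure (Set.range (frobenius k p) ∪ (B₁ : Set k))).map φ :=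
        Subfield.mem_map.mpr ⟨a, h1 a, rfl⟩
      rw [RingHom.map_field_closure] at ha
      refine Subfield.closure_mono ?_ ha
      rintro _ ⟨y, hy | hy, rfl⟩
      · obtain ⟨b, rfl⟩ := hy
        left
        refine ⟨b, ?_⟩
        simp only [hφ, iterateFrobenius_def, frobenius_def, ← pow_mul, ← pow_succ']
      · right
        rw [Finset.coe_union, Finset.coe_image]
        exact Or.inl ⟨y, hy, rfl⟩
    · apply Subfield.subset_closure
      right
      rw [Finset.coe_union]
      exact Or.inr hx

/-- A finitely generated field extension `K/k` is generated by finitely many elements of any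
valuation ring `O` of `K` (replace a generator `x ∉ O` by `x⁻¹ ∈ O`). -/
theorem exists_finset_generators_mem (k K : Type u) [Field k] [Field K] [Algebra k K]
    (hfg : (⊤ : IntermediateField k K).FG) (O : ValuationSubring K) :
    ∃ T : Finset K, (∀ y ∈ T, y ∈ O) ∧ IntermediateField.adjoin k (T : Set K) = ⊤ := by
  classical
  obtain ⟨t, ht⟩ := hfg
  let f : K → K := fun x => if x ∈ O then x else x⁻¹
  refine ⟨t.image f, ?_, ?_⟩
  · intro y hy
    obtain ⟨x, -, rfl⟩ := Finset.mem_image.mp hy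
    by_cases hx : x ∈ O
    · simp [f, hx]
    · simpa [f, hx] using (O.mem_or_inv_mem x).resolve_left hx
  · apply top_le_iff.mp
    rw [← ht]
    refine IntermediateField.adjoin_le_iff.mpr fun x hx => ?_
    have hfx : f x ∈ IntermediateField.adjoin k ((t.image f : Finset K) : Set K) :=
      IntermediateField.subset_adjoin k _ (Finset.mem_image_of_mem f (Finset.mem_coe.mp hx))
    by_cases hxO : x ∈ O
    · simpa [f, hxO] using hfx
    · have : x⁻¹ ∈ IntermediateField.adjoin k ((t.image f : Finset K) : Set K) := by
        simpa [f, hxO] using hfx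
      simpa using inv_mem this

/-- **Finitely many generators of `K` over `k^{pⁿ}` inside `O`.** If `k` is `F`-finite, `K/k` is
finitely generated and `k ⊆ O`, then there is a finite set `G ⊆ O` such that every intermediate
field of `K / k^{pⁿ}` containing `G` is `K` itself. -/
theorem exists_finset_generators_over_frobeniusBaseField (k K : Type u) [Field k] [Field K]
    [Algebra k K] (p : ℕ) [Fact p.Prime] [CharP k p] (hF : Module.Finite (frobenius k p).range k)
    (hfg : (⊤ : IntermediateField k K).FG) (O : ValuationSubring K)
    (hO : ∀ c : k, algebraMap k K c ∈ O) (n : ℕ) :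
    ∃ G : Finset K, (∀ g ∈ G, g ∈ O) ∧
      ∀ E : IntermediateField ((algebraMap k K).comp (iterateFrobenius k p n)).fieldRange K,
        (G : Set K) ⊆ E → E = ⊤ := by
  classical
  obtain ⟨B, hB⟩ := exists_finset_closure_range_iterateFrobenius_eq_top k p hF n
  obtain ⟨T, hTO, hT⟩ := exists_finset_generators_mem k K hfg O
  refine ⟨T ∪ B.image (algebraMap k K), ?_, ?_⟩
  · intro g hg
    rcases Finset.mem_union.mp hg with hg | hg
    · exact hTO g hg
    · obtain ⟨b, -, rfl⟩ := Finset.mem_image.mp hg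
      exact hO b
  · intro E hGE
    rw [Finset.coe_union, Finset.coe_image, Set.union_subset_iff] at hGE
    -- every `algebraMap k K c` lies in `E`
    have hk : ∀ c : k, algebraMap k K c ∈ E := by
      intro c
      have hc : c ∈ Subfield.closure (Set.range (iterateFrobenius k p n) ∪ (B : Set k)) := by
        rw [hB]; trivial
      have hc' : c ∈ (E.toSubfield).comap (algebraMap k K) := by
        refine (Subfield.closure_le.mpr ?_) hc
        rintro x (⟨a, rfl⟩ | hx)
        · change algebraMap k K (iterateFrobenius k p n a) ∈ E
          exact E.algebraMap_mem
            ⟨_, ((algebraMap k K).comp (iterateFrobenius k p n)).mem_fieldRange_self a⟩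
        · exact hGE.2 ⟨x, hx, rfl⟩
      exact hc'
    rw [eq_top_iff]
    intro x _
    have hx : x ∈ (⊤ : IntermediateField k K) := IntermediateField.mem_top
    rw [← hT] at hx
    have hle : (IntermediateField.adjoin k (T : Set K)).toSubfield ≤ E.toSubfield := by
      rw [IntermediateField.adjoin_toSubfield, Subfield.closure_le]
      rintro y (⟨c, rfl⟩ | hy)
      · exact hk c
      · exact hGE.1 hy
    exact hle hx

end Summit.ResolutionOfSingularities.ResolutionOfSingularities.Theorems

end
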